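import Mathlib
import Literature.Analysis.UnboundedOperators.ConjugateOperatorRegularity
import Literature.Analysis.UnboundedOperators.UnitaryRepSpectralMeasure
import Literature.Analysis.UnboundedOperators.FourierSpectrumCalculus
import HarnessLib
import Summits.AtomisticToContinuum.FouriersLaw.Theorems.EmbeddedDrudeMourreMourreDissolutionLAPResolventRegularity
import Summits.AtomisticToContinuum.FouriersLaw.Theorems.EmbeddedDrudeMourreMourreDissolutionLAPBoundedCalculus
import Summits.AtomisticToContinuum.FouriersLaw.Theorems.EmbeddedDrudeMourreMourreDissolutionLAPSymbolExp
import Summits.AtomisticToContinuum.FouriersLaw.Theorems.EmbeddedDrudeMourreMourreDissolutionLAPCutoffFactorisation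

/-!
# Stub `stub_mourreThresholdLAP` — Mourre LAP infrastructure 17: `H ∈ C¹ ∩ 𝒞^{1,1}(A) ⇒ φ(H) ∈ C¹ ∩ 𝒞^{1,1}(A; H)`

Item `stmt-AtomisticToContinuum-12594` (crux `MourreDissolution` of route `EmbeddedDrudeMourre`,
sub-problem `FouriersLaw`), line `separable-vertex-faddeev-pair-sector`, stub S6
`stub_mourreThresholdLAP` (Mourre's limiting absorption principle; NOT in the tree). This file
CLOSES step L3 of the proof map — ABG Thm 6.2.5 for `(s, p) = (1, 1)` in the resolvent form of the
hypotheses (`HamiltonianOfClassC1/C11 U A`, i.e. `R(-i) ∈ C¹ ∩ 𝒞^{1,1}(A; H)`) — by route (b),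
spectral-theorem free, assembling parts 9 and 11–16:

* §1 the commuting bounded self-adjoint pair `T_c = R(c+i)R(c-i)`, `S_c = ½(R(c+i) + R(c-i))`
  (in `C¹ ∩ 𝒞^{1,1}` by parts 7–9) and their symbol data: symbols `t = 1/(1+(ξ-c)²)`,
  `s = (ξ-c)/(1+(ξ-c)²)` (part 14–15);
* §2 the joint unitary group on the spectral side, `⟪v, e^{iτT_c} e^{iσS_c} v⟫ = ∫ e^{iτt} e^{iσs} dμ_v`,
  and the product of the two bounded calculi (part 13),
  `⟪v, g₁(T_c/2π) χ(S_c/2π) v⟫ = ∫ g₁(t/2π) χ(s/2π) dμ_v` (Fubini twice, Fourier inversion twice);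
* §3 by the factorisation of part 16, `g(H/2π) = g₁(T_c/2π) χ(S_c/2π)` for compactly supported
  Schwartz `g` (equality of all diagonal matrix elements), hence
  `g(H/2π), (energyMul g)(H/2π) ∈ C¹(A; H) ∩ 𝒞^{1,1}(A; H)` — headline
  `fourierCalculus_regular_of_hamiltonianOfClass` (the local regularity consumed by L5).
-/

noncomputable section

open MeasureTheory Complex Filter Topology Set
open scoped InnerProductSpace ComplexConjugate SchwartzMap FourierTransform ENNReal NNReal

namespace Summit.AtomisticToContinuum.FouriersLaw.Theorems.MourreDissolution

open Literature.Analysis.UnboundedOperators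
open Literature.Analysis.UnboundedOperators.UnitaryRep

variable {H : Type*} [NormedAddCommGroup H] [InnerProductSpace ℂ H] [CompleteSpace H]

/-! ## §1. The commuting self-adjoint pair `T_c`, `S_c` and their symbols -/

/-- `Im (c + i) = 1 ≠ 0`. [folklore] -/
theorem im_add_I_ne (c : ℝ) : ((c : ℂ) + I).im ≠ 0 := by simp
/-- `Im (c - i) = -1 ≠ 0`. [folklore] -/
theorem im_sub_I_ne (c : ℝ) : ((c : ℂ) - I).im ≠ 0 := by simp

/-- **`T_c = R(c+i) R(c-i) = ((H-c)² + 1)⁻¹`.** [folklore] -/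
def tOp (U : OneParameterUnitaryGroup H) (c : ℝ) : H →L[ℂ] H :=
  resolventAt U ((c : ℂ) + I) * resolventAt U ((c : ℂ) - I)

/-- **`S_c = ½ (R(c+i) + R(c-i)) = (H-c)((H-c)² + 1)⁻¹`.** [folklore] -/
def sOp (U : OneParameterUnitaryGroup H) (c : ℝ) : H →L[ℂ] H :=
  (1 / 2 : ℂ) • (resolventAt U ((c : ℂ) + I) + resolventAt U ((c : ℂ) - I))

/-- `R(c-i)* = R(c+i)`. [folklore] -/
theorem adjoint_resolventAt_sub_I (U : OneParameterUnitaryGroup H) (c : ℝ) :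
    ContinuousLinearMap.adjoint (resolventAt U ((c : ℂ) - I)) = resolventAt U ((c : ℂ) + I) := by
  rw [adjoint_resolventAt (im_sub_I_ne c)]; congr 1; simp

/-- `R(c+i)* = R(c-i)`. [folklore] -/
theorem adjoint_resolventAt_add_I (U : OneParameterUnitaryGroup H) (c : ℝ) :
    ContinuousLinearMap.adjoint (resolventAt U ((c : ℂ) + I)) = resolventAt U ((c : ℂ) - I) := by
  rw [adjoint_resolventAt (im_add_I_ne c)]; congr 1; simp [sub_eq_add_neg]

/-- `T_c` is self-adjoint (`(R₊R₋)* = R₋* R₊* = R₊ R₋`). [folklore] -/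
theorem isSelfAdjoint_tOp (U : OneParameterUnitaryGroup H) (c : ℝ) : IsSelfAdjoint (tOp U c) := by
  rw [IsSelfAdjoint, tOp, star_mul, ContinuousLinearMap.star_eq_adjoint,
    ContinuousLinearMap.star_eq_adjoint, adjoint_resolventAt_sub_I, adjoint_resolventAt_add_I]

/-- `S_c` is self-adjoint. [folklore] -/
theorem isSelfAdjoint_sOp (U : OneParameterUnitaryGroup H) (c : ℝ) : IsSelfAdjoint (sOp U c) := by
  have h1 : IsSelfAdjoint (resolventAt U ((c : ℂ) + I) + resolventAt U ((c : ℂ) - I)) := by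
    rw [ContinuousLinearMap.isSelfAdjoint_iff', map_add, adjoint_resolventAt_add_I,
      adjoint_resolventAt_sub_I, add_comm]
  rw [sOp]
  refine (IsSelfAdjoint.smul ?_ h1)
  rw [IsSelfAdjoint, Complex.star_def]
  simp [Complex.ext_iff]

/-- `T_c` and `S_c` commute. [folklore] -/
theorem commute_tOp_sOp (U : OneParameterUnitaryGroup H) (c : ℝ) : Commute (tOp U c) (sOp U c) := by
  have hc : Commute (resolventAt U ((c : ℂ) + I)) (resolventAt U ((c : ℂ) - I)) :=
    resolventAt_comm (im_add_I_ne c) (im_sub_I_ne c) U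
  have h1 : Commute (tOp U c) (resolventAt U ((c : ℂ) + I)) :=
    (Commute.refl _).mul_left hc.symm
  have h2 : Commute (tOp U c) (resolventAt U ((c : ℂ) - I)) := hc.mul_left (Commute.refl _)
  exact (h1.add_right h2).smul_right _

/-- **`T_c ∈ C¹ ∩ 𝒞^{1,1}(A; H)` under the stub's hypotheses.** [cite: AmreinBoutetdeMonvelGeorgescu1996, Lemma 6.2.1] -/
theorem tOp_regular {U A : OneParameterUnitaryGroup H} (h1 : U.HamiltonianOfClassC1 A)
    (h11 : U.HamiltonianOfClassC11 A) (c : ℝ) : A.IsOfClassC1 (tOp U c) ∧ A.IsOfClassC11 (tOp U c) :=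
  isOfClassC1_and_C11_mul (isOfClassC1_resolventAt h1 (im_add_I_ne c))
    (isOfClassC11_resolventAt h1 h11 (im_add_I_ne c)) (isOfClassC1_resolventAt h1 (im_sub_I_ne c))
    (isOfClassC11_resolventAt h1 h11 (im_sub_I_ne c))

/-- **`S_c ∈ C¹ ∩ 𝒞^{1,1}(A; H)` under the stub's hypotheses.** [cite: AmreinBoutetdeMonvelGeorgescu1996, Lemma 6.2.1] -/
theorem sOp_regular {U A : OneParameterUnitaryGroup H} (h1 : U.HamiltonianOfClassC1 A)
    (h11 : U.HamiltonianOfClassC11 A) (c : ℝ) : A.IsOfClassC1 (sOp U c) ∧ A.IsOfClassC11 (sOp U c) :=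
  ⟨((isOfClassC1_resolventAt h1 (im_add_I_ne c)).add (isOfClassC1_resolventAt h1 (im_sub_I_ne c))).smul _,
    isOfClassC11_smul (isOfClassC11_add (isOfClassC11_resolventAt h1 h11 (im_add_I_ne c))
      (isOfClassC11_resolventAt h1 h11 (im_sub_I_ne c))) _⟩

/-- The symbol datum of `T_c`. [folklore] -/
def tDatum (c : ℝ) : SymbolDatum :=
  (resolventDatum (im_add_I_ne c)).mul (resolventDatum (im_sub_I_ne c))
/-- The symbol datum of `S_c`. [folklore] -/
def sDatum (c : ℝ) : SymbolDatum :=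
  SymbolDatum.smul (1 / 2) ((resolventDatum (im_add_I_ne c)).add (resolventDatum (im_sub_I_ne c)))

/-- `(tDatum c).op U = T_c`. [folklore] -/
theorem tDatum_op (U : OneParameterUnitaryGroup H) (c : ℝ) : (tDatum c).op U = tOp U c := by
  rw [tDatum, SymbolDatum.op_mul, resolventDatum_op, resolventDatum_op, tOp]
/-- `(sDatum c).op U = S_c`. [folklore] -/
theorem sDatum_op (U : OneParameterUnitaryGroup H) (c : ℝ) : (sDatum c).op U = sOp U c := by
  rw [sDatum, SymbolDatum.op_smul, SymbolDatum.op_add, resolventDatum_op, resolventDatum_op, sOp]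

/-- `(ξ - c)² + 1 ≠ 0` in `ℂ`. [folklore] -/
theorem sq_add_one_ne_zero (ξ c : ℝ) : ((ξ : ℂ) - c) ^ 2 + 1 ≠ 0 := by
  have : ((ξ : ℂ) - c) ^ 2 + 1 = (((ξ - c) ^ 2 + 1 : ℝ) : ℂ) := by push_cast; ring
  rw [this]
  exact Complex.ofReal_ne_zero.2 (by positivity)

/-- **The symbol of `T_c` is `t = 1/(1 + (ξ - c)²)`.** [folklore] -/
theorem tDatum_fn (c ξ : ℝ) : (tDatum c).fn ξ = ((1 / (1 + (ξ - c) ^ 2) : ℝ) : ℂ) := by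
  rw [tDatum, SymbolDatum.fn_mul, resolventDatum_fn, resolventDatum_fn]
  have h1 : (ξ : ℂ) - ((c : ℂ) + I) ≠ 0 := fun h => by simpa using congrArg Complex.im h
  have h2 : (ξ : ℂ) - ((c : ℂ) - I) ≠ 0 := fun h => by simpa using congrArg Complex.im h
  have h3 := sq_add_one_ne_zero ξ c
  have key : ((ξ : ℂ) - ((c : ℂ) + I)) * ((ξ : ℂ) - ((c : ℂ) - I)) = ((ξ : ℂ) - c) ^ 2 + 1 := by
    ring_nf; rw [Complex.I_sq]; ring
  rw [div_mul_div_comm, one_mul, key]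
  push_cast
  rw [add_comm]

/-- **The symbol of `S_c` is `s = (ξ - c)/(1 + (ξ - c)²)`.** [folklore] -/
theorem sDatum_fn (c ξ : ℝ) : (sDatum c).fn ξ = (((ξ - c) / (1 + (ξ - c) ^ 2) : ℝ) : ℂ) := by
  rw [sDatum, SymbolDatum.fn_smul, SymbolDatum.fn_add, resolventDatum_fn, resolventDatum_fn]
  have h1 : (ξ : ℂ) - ((c : ℂ) + I) ≠ 0 := fun h => by simpa using congrArg Complex.im h
  have h2 : (ξ : ℂ) - ((c : ℂ) - I) ≠ 0 := fun h => by simpa using congrArg Complex.im h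
  have h3 := sq_add_one_ne_zero ξ c
  have key : ((ξ : ℂ) - ((c : ℂ) + I)) * ((ξ : ℂ) - ((c : ℂ) - I)) = ((ξ : ℂ) - c) ^ 2 + 1 := by
    ring_nf; rw [Complex.I_sq]; ring
  rw [div_add_div _ _ h1 h2, key]
  push_cast
  rw [add_comm (1 : ℂ)]
  field_simp
  ring

/-! ## §2. The joint group and the product of the two bounded calculi on the spectral side -/

/-- Commuting exponents combine: `e^{iτP} e^{iσQ} = e^{i(τP + σQ)}` for commuting `P, Q`. [folklore] -/
theorem expI_mul_expI_of_commute {P Q : H →L[ℂ] H} (h : Commute P Q) (τ σ : ℝ) :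
    expI P τ * expI Q σ = expI ((τ : ℂ) • P + (σ : ℂ) • Q) 1 := by
  let _ : NormedAlgebra ℚ (H →L[ℂ] H) := .restrictScalars ℚ ℂ _
  have hc : Commute (τ • (I • P)) (σ • (I • Q)) :=
    ((((h.smul_right I).smul_left I).smul_right σ).smul_left τ)
  unfold expI
  rw [← NormedSpace.exp_add_of_commute hc, one_smul, smul_add, ← Complex.coe_smul, ← Complex.coe_smul,
    smul_comm I (τ : ℂ) P, smul_comm I (σ : ℂ) Q, Complex.coe_smul, Complex.coe_smul]

/-- **The joint unitary group on the spectral side**: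
`⟪v, e^{iτT_c} e^{iσS_c} v⟫ = ∫ e^{iτ t(ξ)} e^{iσ s(ξ)} dμ_v(ξ)`. [folklore] -/
theorem inner_expI_tOp_expI_sOp (U : OneParameterUnitaryGroup H) (c τ σ : ℝ) (v : H) :
    ⟪v, expI (tOp U c) τ (expI (sOp U c) σ v)⟫_ℂ =
      ∫ ξ, cexp ((((1 / (1 + (ξ - c) ^ 2)) * τ : ℝ) : ℂ) * I) *
        cexp (((((ξ - c) / (1 + (ξ - c) ^ 2)) * σ : ℝ) : ℂ) * I) ∂(specMeasure U v) := by
  have e : expI (tOp U c) τ * expI (sOp U c) σ =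
      expI ((((tDatum c).smul τ).add ((sDatum c).smul σ)).op U) 1 := by
    rw [expI_mul_expI_of_commute (commute_tOp_sOp U c), SymbolDatum.op_add, SymbolDatum.op_smul,
      SymbolDatum.op_smul, tDatum_op, sDatum_op]
  rw [show expI (tOp U c) τ (expI (sOp U c) σ v) = (expI (tOp U c) τ * expI (sOp U c) σ) v from rfl,
    e, SymbolDatum.inner_expI_op_eq]
  refine integral_congr_ae (ae_of_all _ fun ξ => ?_)
  simp only [SymbolDatum.fn_add, SymbolDatum.fn_smul, tDatum_fn, sDatum_fn, ← Complex.exp_add]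
  congr 1
  push_cast
  ring

/-- The two-variable integrand `k(a) Φ(ξ, a)` with `|Φ| ≤ C` continuous is integrable on
`ℝ × (ℝ, μ)` for a finite `μ` and a Schwartz `k`. [folklore] -/
theorem integrable_schwartz_mul_prod (μ : Measure ℝ) [IsFiniteMeasure μ] (k : 𝓢(ℝ, ℂ))
    {Φ : ℝ → ℝ → ℂ} (hΦ : Continuous (Function.uncurry Φ)) {C : ℝ} (hC : ∀ a ξ, ‖Φ a ξ‖ ≤ C) :
    Integrable (Function.uncurry fun (a ξ : ℝ) => k a * Φ a ξ) ((volume : Measure ℝ).prod μ) := by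
  have h1 : Integrable (fun z : ℝ × ℝ => ‖k z.1‖ * C) ((volume : Measure ℝ).prod μ) :=
    (k.integrable.norm).mul_prod (integrable_const C)
  refine h1.mono' ((k.continuous.comp continuous_fst).mul hΦ).aestronglyMeasurable
    (ae_of_all _ fun z => ?_)
  change ‖k z.1 * Φ z.1 z.2‖ ≤ ‖k z.1‖ * C
  rw [norm_mul]
  gcongr
  exact hC z.1 z.2

/-- **The product of the two bounded calculi on the spectral side**:
`⟪v, g₁(T_c/2π) χ(S_c/2π) v⟫ = ∫ g₁(t(ξ)/2π) χ(s(ξ)/2π) dμ_v(ξ)` (Fubini twice, Fourier inversion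
`∫ 𝓕g(a) e^{iEa} da = g(E/2π)` twice). [folklore] -/
theorem inner_expCalculus_tOp_mul_sOp (U : OneParameterUnitaryGroup H) (c : ℝ) (g₁ χ : 𝓢(ℝ, ℂ))
    (v : H) :
    ⟪v, (expCalculus (tOp U c) g₁ * expCalculus (sOp U c) χ) v⟫_ℂ =
      ∫ ξ, g₁ ((1 / (1 + (ξ - c) ^ 2)) / (2 * Real.pi)) *
        χ (((ξ - c) / (1 + (ξ - c) ^ 2)) / (2 * Real.pi)) ∂(specMeasure U v) := by
  set μ := specMeasure U v with hμ
  set t : ℝ → ℝ := fun ξ => 1 / (1 + (ξ - c) ^ 2) with ht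
  set s : ℝ → ℝ := fun ξ => (ξ - c) / (1 + (ξ - c) ^ 2) with hs
  have hT := isSelfAdjoint_tOp U c
  have hS := isSelfAdjoint_sOp U c
  have ht_cont : Continuous t := by
    simp only [ht]
    exact continuous_const.div (by fun_prop) fun ξ => by positivity
  have hs_cont : Continuous s := by
    simp only [hs]
    exact (continuous_id.sub continuous_const).div (by fun_prop) fun ξ => by positivity
  -- the joint matrix element as a function of `(τ, σ)`
  have hjoint : ∀ τ σ : ℝ, ⟪expI (tOp U c) (-τ) v, expI (sOp U c) σ v⟫_ℂ =
      ∫ ξ, cexp (((t ξ * τ : ℝ) : ℂ) * I) * cexp (((s ξ * σ : ℝ) : ℂ) * I) ∂μ := by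
    intro τ σ
    have had : ContinuousLinearMap.adjoint (expI (tOp U c) τ) = expI (tOp U c) (-τ) := by
      rw [← ContinuousLinearMap.star_eq_adjoint, star_expI hT]
    rw [← had, ContinuousLinearMap.adjoint_inner_left]
    exact inner_expI_tOp_expI_sOp U c τ σ v
  -- step 1: the inner calculus, `σ`-integral against `μ`
  have hinner : ∀ τ : ℝ, ⟪v, expI (tOp U c) τ (expCalculus (sOp U c) χ v)⟫_ℂ =
      ∫ ξ, cexp (((t ξ * τ : ℝ) : ℂ) * I) * χ (s ξ / (2 * Real.pi)) ∂μ := by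
    intro τ
    have had : ContinuousLinearMap.adjoint (expI (tOp U c) τ) = expI (tOp U c) (-τ) := by
      rw [← ContinuousLinearMap.star_eq_adjoint, star_expI hT]
    rw [← ContinuousLinearMap.adjoint_inner_left, had, inner_expCalculus hS χ]
    simp_rw [hjoint τ]
    have hint := integrable_schwartz_mul_prod μ (𝓕 χ : 𝓢(ℝ, ℂ))
      (Φ := fun σ ξ => cexp (((t ξ * τ : ℝ) : ℂ) * I) * cexp (((s ξ * σ : ℝ) : ℂ) * I))
      (by fun_prop) (C := 1) (fun σ ξ => by
        rw [norm_mul, norm_cexp_real_mul_I, norm_cexp_real_mul_I, mul_one])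
    calc ∫ σ, (𝓕 χ : 𝓢(ℝ, ℂ)) σ * ∫ ξ, cexp (((t ξ * τ : ℝ) : ℂ) * I) *
            cexp (((s ξ * σ : ℝ) : ℂ) * I) ∂μ
        = ∫ σ, ∫ ξ, (𝓕 χ : 𝓢(ℝ, ℂ)) σ * (cexp (((t ξ * τ : ℝ) : ℂ) * I) *
            cexp (((s ξ * σ : ℝ) : ℂ) * I)) ∂μ := by
          refine integral_congr_ae (ae_of_all _ fun σ => ?_)
          simp only
          rw [← integral_const_mul]
      _ = ∫ ξ, (∫ σ, (𝓕 χ : 𝓢(ℝ, ℂ)) σ * (cexp (((t ξ * τ : ℝ) : ℂ) * I) *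
            cexp (((s ξ * σ : ℝ) : ℂ) * I))) ∂μ := integral_integral_swap hint
      _ = ∫ ξ, cexp (((t ξ * τ : ℝ) : ℂ) * I) * χ (s ξ / (2 * Real.pi)) ∂μ := by
          refine integral_congr_ae (ae_of_all _ fun ξ => ?_)
          simp only
          rw [← integral_fourier_mul_cexp χ (s ξ), ← integral_const_mul]
          refine integral_congr_ae (ae_of_all _ fun σ => ?_)
          simp only
          ring
  -- step 2: the outer calculus, `τ`-integral against `μ`
  rw [show (expCalculus (tOp U c) g₁ * expCalculus (sOp U c) χ) v =
      expCalculus (tOp U c) g₁ (expCalculus (sOp U c) χ v) from rfl, inner_expCalculus hT g₁]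
  simp_rw [hinner]
  have hχb : ∀ ξ, ‖χ (s ξ / (2 * Real.pi))‖ ≤ SchwartzMap.seminorm ℂ 0 0 χ := fun ξ =>
    norm_apply_le_seminorm χ _
  have hint := integrable_schwartz_mul_prod μ (𝓕 g₁ : 𝓢(ℝ, ℂ))
    (Φ := fun τ ξ => cexp (((t ξ * τ : ℝ) : ℂ) * I) * χ (s ξ / (2 * Real.pi)))
    (by fun_prop) (C := SchwartzMap.seminorm ℂ 0 0 χ) (fun τ ξ => by
      rw [norm_mul, norm_cexp_real_mul_I, one_mul]; exact hχb ξ)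
  calc ∫ τ, (𝓕 g₁ : 𝓢(ℝ, ℂ)) τ * ∫ ξ, cexp (((t ξ * τ : ℝ) : ℂ) * I) * χ (s ξ / (2 * Real.pi)) ∂μ
      = ∫ τ, ∫ ξ, (𝓕 g₁ : 𝓢(ℝ, ℂ)) τ * (cexp (((t ξ * τ : ℝ) : ℂ) * I) *
          χ (s ξ / (2 * Real.pi))) ∂μ := by
        refine integral_congr_ae (ae_of_all _ fun τ => ?_)
        simp only
        rw [← integral_const_mul]
    _ = ∫ ξ, (∫ τ, (𝓕 g₁ : 𝓢(ℝ, ℂ)) τ * (cexp (((t ξ * τ : ℝ) : ℂ) * I) *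
          χ (s ξ / (2 * Real.pi)))) ∂μ := integral_integral_swap hint
    _ = ∫ ξ, g₁ (t ξ / (2 * Real.pi)) * χ (s ξ / (2 * Real.pi)) ∂μ := by
        refine integral_congr_ae (ae_of_all _ fun ξ => ?_)
        simp only
        rw [← integral_fourier_mul_cexp g₁ (t ξ), ← integral_mul_const]
        refine integral_congr_ae (ae_of_all _ fun τ => ?_)
        simp only
        ring

/-! ## §3. `g(H/2π) = g₁(T_c/2π) χ(S_c/2π)` and the regularity of `g(H/2π)` -/

omit [CompleteSpace H] in
/-- **Bounded operators with equal diagonal matrix elements are equal** (complex polarisation).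
[folklore] -/
theorem eq_of_forall_inner_eq {B₁ B₂ : H →L[ℂ] H} (h : ∀ v : H, ⟪v, B₁ v⟫_ℂ = ⟪v, B₂ v⟫_ℂ) :
    B₁ = B₂ := by
  have h0 : ∀ v : H, ⟪((B₁ - B₂ : H →L[ℂ] H) : H →ₗ[ℂ] H) v, v⟫_ℂ = 0 := fun v => by
    rw [ContinuousLinearMap.coe_coe, _root_.sub_apply, inner_sub_left, ← inner_conj_symm (B₁ v) v,
      ← inner_conj_symm (B₂ v) v, h v, sub_self]
  have := (inner_map_self_eq_zero _).1 h0
  refine sub_eq_zero.1 (ContinuousLinearMap.ext fun v => ?_)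
  exact LinearMap.congr_fun this v

/-- **`g(H/2π) = g₁(T_c/2π) χ(S_c/2π)`** whenever the symbols factor:
`g(ξ/2π) = g₁(t(ξ)/2π) χ(s(ξ)/2π)` for all real `ξ`. [folklore] -/
theorem fourierCalculus_eq_expCalculus_mul (U : OneParameterUnitaryGroup H) (c : ℝ) {g g₁ χ : 𝓢(ℝ, ℂ)}
    (hfac : ∀ ξ : ℝ, g (ξ / (2 * Real.pi)) = g₁ ((1 / (1 + (ξ - c) ^ 2)) / (2 * Real.pi)) *
      χ (((ξ - c) / (1 + (ξ - c) ^ 2)) / (2 * Real.pi))) :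
    U.fourierCalculus g = expCalculus (tOp U c) g₁ * expCalculus (sOp U c) χ :=
  eq_of_forall_inner_eq fun v => by
    rw [inner_fourierCalculus_eq_integral_specMeasure, inner_expCalculus_tOp_mul_sOp]
    exact integral_congr_ae (ae_of_all _ fun ξ => hfac ξ)

/-- A smooth compactly supported function, rescaled by `2π`, is a Schwartz symbol:
`∃ g, g(u/2π) = Φ(u)`. [folklore] -/
theorem exists_schwartz_rescale (Φ : ℝ → ℂ) (hΦ : ContDiff ℝ ((⊤ : ℕ∞) : WithTop ℕ∞) Φ)
    (hK : HasCompactSupport Φ) : ∃ g : 𝓢(ℝ, ℂ), ∀ u : ℝ, g (u / (2 * Real.pi)) = Φ u := by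
  set f : ℝ → ℂ := fun w => Φ (2 * Real.pi * w) with hf
  have hfd : ContDiff ℝ ((⊤ : ℕ∞) : WithTop ℕ∞) f := hΦ.comp (contDiff_const.mul contDiff_id)
  have hfK : HasCompactSupport f :=
    hK.comp_homeomorph (Homeomorph.mulLeft₀ (2 * Real.pi) (by positivity))
  refine ⟨hfK.toSchwartzMap hfd, fun u => ?_⟩
  show f (u / (2 * Real.pi)) = Φ u
  simp only [hf]
  congr 1
  field_simp

/-- `x ↦ g(x/2π)` is smooth and compactly supported when `g` is. [folklore] -/
theorem rescale_smooth_compact (g : 𝓢(ℝ, ℂ)) (hg : HasCompactSupport (g : ℝ → ℂ)) :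
    ContDiff ℝ ((⊤ : ℕ∞) : WithTop ℕ∞) (fun x : ℝ => g (x / (2 * Real.pi))) ∧
      HasCompactSupport (fun x : ℝ => g (x / (2 * Real.pi))) := by
  refine ⟨(g.smooth _).comp (contDiff_id.div_const _), ?_⟩
  have h2 : (2 * Real.pi : ℝ)⁻¹ ≠ 0 := inv_ne_zero (by positivity)
  have := hg.comp_homeomorph (Homeomorph.mulRight₀ (2 * Real.pi)⁻¹ h2)
  have e : ((g : ℝ → ℂ) ∘ (Homeomorph.mulRight₀ (2 * Real.pi)⁻¹ h2)) =
      fun x : ℝ => g (x / (2 * Real.pi)) := by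
    funext x
    simp [div_eq_mul_inv]
  rwa [e] at this

/-- `energyMul g` is compactly supported when `g` is. [folklore] -/
theorem hasCompactSupport_energyMul {g : 𝓢(ℝ, ℂ)} (hg : HasCompactSupport (g : ℝ → ℂ)) :
    HasCompactSupport ((energyMul g : 𝓢(ℝ, ℂ)) : ℝ → ℂ) := by
  have : ((energyMul g : 𝓢(ℝ, ℂ)) : ℝ → ℂ) = fun ξ => ((2 * Real.pi * ξ : ℝ) : ℂ) * g ξ :=
    funext (energyMul_apply g)
  rw [this]
  exact hg.mul_left

/-- **ABG Theorem 6.2.5, `(s, p) = (1, 1)`, resolvent form**: `H ∈ C¹(A) ∩ 𝒞^{1,1}(A)` (i.e.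
`R(-i) ∈ C¹ ∩ 𝒞^{1,1}(A; H)`) implies `g(H/2π) ∈ C¹(A; H) ∩ 𝒞^{1,1}(A; H)` for every compactly
supported Schwartz `g` (route (b): `g(H/2π) = g₁(T_c/2π) χ(S_c/2π)` with `T_c, S_c ∈ C¹ ∩ 𝒞^{1,1}`
and the bounded calculi of part 13). [cite: AmreinBoutetdeMonvelGeorgescu1996, Thm. 6.2.5] -/
theorem fourierCalculus_regular {U A : OneParameterUnitaryGroup H} (h1 : U.HamiltonianOfClassC1 A)
    (h11 : U.HamiltonianOfClassC11 A) (g : 𝓢(ℝ, ℂ)) (hg : HasCompactSupport (g : ℝ → ℂ)) :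
    A.IsOfClassC1 (U.fourierCalculus g) ∧ A.IsOfClassC11 (U.fourierCalculus g) := by
  obtain ⟨hφ, hφK⟩ := rescale_smooth_compact g hg
  obtain ⟨c, Φ₁, Χ, hΦ₁, hΦ₁K, hΧ, hΧK, hfac⟩ :=
    compactlySupported_factorsThrough_resolventVariables _ hφ hφK
  obtain ⟨g₁, hg₁⟩ := exists_schwartz_rescale Φ₁ hΦ₁ hΦ₁K
  obtain ⟨χ, hχ⟩ := exists_schwartz_rescale Χ hΧ hΧK
  have hfac' : ∀ ξ : ℝ, g (ξ / (2 * Real.pi)) = g₁ ((1 / (1 + (ξ - c) ^ 2)) / (2 * Real.pi)) *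
      χ (((ξ - c) / (1 + (ξ - c) ^ 2)) / (2 * Real.pi)) := fun ξ => by
    rw [hg₁, hχ]
    exact hfac ξ
  rw [fourierCalculus_eq_expCalculus_mul U c hfac']
  obtain ⟨hT1, hT11⟩ := tOp_regular h1 h11 c
  obtain ⟨hS1, hS11⟩ := sOp_regular h1 h11 c
  exact isOfClassC1_and_C11_mul (isOfClassC1_expCalculus (isSelfAdjoint_tOp U c) hT1 g₁)
    (isOfClassC11_expCalculus (isSelfAdjoint_tOp U c) hT1 hT11 g₁)
    (isOfClassC1_expCalculus (isSelfAdjoint_sOp U c) hS1 χ)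
    (isOfClassC11_expCalculus (isSelfAdjoint_sOp U c) hS1 hS11 χ)

/-- The same for `φ₁(H) = (energyMul g)(H/2π) = H g(H/2π)`. [cite: AmreinBoutetdeMonvelGeorgescu1996, Thm. 6.2.5] -/
theorem fourierCalculus_energyMul_regular {U A : OneParameterUnitaryGroup H}
    (h1 : U.HamiltonianOfClassC1 A) (h11 : U.HamiltonianOfClassC11 A) (g : 𝓢(ℝ, ℂ))
    (hg : HasCompactSupport (g : ℝ → ℂ)) :
    A.IsOfClassC1 (U.fourierCalculus (energyMul g)) ∧ A.IsOfClassC11 (U.fourierCalculus (energyMul g)) :=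
  fourierCalculus_regular h1 h11 (energyMul g) (hasCompactSupport_energyMul hg)

/-- **Admissible cutoffs of a Mourre window are regular**: for `IsRealCutoffOn J g`,
`g(H/2π), (energyMul g)(H/2π) ∈ C¹(A; H) ∩ 𝒞^{1,1}(A; H)`. [cite: AmreinBoutetdeMonvelGeorgescu1996, Thm. 6.2.5] -/
theorem IsRealCutoffOn.regular {U A : OneParameterUnitaryGroup H} {J : Set ℝ} {g : 𝓢(ℝ, ℂ)}
    (hg : IsRealCutoffOn J g) (h1 : U.HamiltonianOfClassC1 A) (h11 : U.HamiltonianOfClassC11 A) :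
    (A.IsOfClassC1 (U.fourierCalculus g) ∧ A.IsOfClassC11 (U.fourierCalculus g)) ∧
      (A.IsOfClassC1 (U.fourierCalculus (energyMul g)) ∧
        A.IsOfClassC11 (U.fourierCalculus (energyMul g))) :=
  ⟨fourierCalculus_regular h1 h11 g hg.2.1, fourierCalculus_energyMul_regular h1 h11 g hg.2.1⟩

/-! ## §4. Headline (registered helper stub) -/

/-- **`H ∈ C¹(A) ∩ 𝒞^{1,1}(A) ⇒ φ(H), Hφ(H) ∈ C¹(A; H) ∩ 𝒞^{1,1}(A; H)` for compactly supported smooth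
`φ`, headline form** (all binders explicit; registered helper stub of `stub_mourreThresholdLAP`;
ABG Thm 6.2.5 for `(s, p) = (1, 1)`, `k = 1`, in the resolvent form of the hypotheses): for a
compactly supported Schwartz symbol `g`, the operators `g(H/2π) = U.fourierCalculus g` and
`(energyMul g)(H/2π) = H g(H/2π)` are of class `C¹(A; H)` and `𝒞^{1,1}(A; H)`.
[cite: AmreinBoutetdeMonvelGeorgescu1996, Thm. 6.2.5] -/
theorem fourierCalculus_regular_of_hamiltonianOfClass :
    ∀ (K : Type) [NormedAddCommGroup K] [InnerProductSpace ℂ K] [CompleteSpace K]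
      (U A : Literature.Analysis.UnboundedOperators.OneParameterUnitaryGroup K) (g : SchwartzMap ℝ ℂ),
      U.HamiltonianOfClassC1 A → U.HamiltonianOfClassC11 A → HasCompactSupport (g : ℝ → ℂ) →
        (A.IsOfClassC1 (U.fourierCalculus g) ∧ A.IsOfClassC11 (U.fourierCalculus g)) ∧
          (A.IsOfClassC1
              (U.fourierCalculus (Literature.Analysis.UnboundedOperators.UnitaryRep.energyMul g)) ∧
            A.IsOfClassC11
              (U.fourierCalculus (Literature.Analysis.UnboundedOperators.UnitaryRep.energyMul g))) := by
  intro K _ _ _ U A g h1 h11 hg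
  exact ⟨fourierCalculus_regular h1 h11 g hg, fourierCalculus_energyMul_regular h1 h11 g hg⟩

end Summit.AtomisticToContinuum.FouriersLaw.Theorems.MourreDissolution
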